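import Summits.QuantumFields.BalabanUV.T4Continuum.Support.NE3CoarseInterpolant
import Summits.QuantumFields.BalabanUV.T4Continuum.Support.NE3CombGauge
import HarnessLib

/-!
# T⁴ programme, node NE3 — row E-MLw-(w4)-P-curved, route H♮, row K5c: THE COVARIANT TENT INTERPOLANT — a covariant
# interpolant of coarse 𝔤-valued data WITHOUT per-block frames, and its covariant Dirichlet energy in the S7 shape

NE3 (node U1b) formalisation swarm, leaf seat `b2b-balaban-t4-ne3-formalise-leaf-01` (gen 6); row **K5** of ruling ρ-g22-2
(`HOME/t4/b2b-balaban-t4-ne3-p1/g22/D-ne3p1-g22-1.md` §2 S7 «covariant block-mean-exact interpolant with defect cost», holder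
leaf-01), sub-row **K5c** (FINDING F-ne3leaf01g6-1, `HOME/CLAIMS.log` 2026-08-20 ≈18:08Z; INTENT ≈18:15Z).

WHY A NEW OBJECT.  The lineage's K5b competitor `NE3CovariantInterpolantCore.IW` dresses the flat interpolant of block `z` by the
tree transport from the block's OWN corner `M•z`.  At a face of direction `κ ≠ d−1` the two neighbouring frames then differ by a
RIBBON loop (area `M·Σ_{j>κ}(x − M•z)_j` plaquettes, varying with the face site), so no coarse bond value is within `O(M·a)` of the
face transports and the face bonds cost `M^{d−1}·O((M²a)²)·Σ‖m‖²` — a factor `M = L^k` above the S7 budget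
`C·M^{d−2}·[Σ‖D_U m‖² + ((M²a)² + δ²)·Σ‖m‖²]`.  THE REPAIR is the classical one (patch local gauges with a partition of unity,
[Balaban1985RegularSpaces] §1): carry EACH cube-vertex datum `m w` to the fine site `y` from ITS OWN corner `M•w` along the tree word
`treeWord (y − M•w)` (the tree's `btree M W w y = axialFn W (M•w) y`, defined for every `y`, signed segments), and combine the `2^d`
transported values with the multilinear weights of `SmoothRefineInterp.interp` (the tent partition of unity of the coarse lattice):
**`tinterpW M W m y := interp M univ (fun w => Ad (btree M W w y)⁻¹ (m w)) y`**.  There is no per-block frame, hence no face: every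
fine bond is treated alike, and the frame change between neighbouring vertices `w, w + e_α` enters ONLY through the coarse-difference
slot of the difference formula (weight `1∕M`), where an `O(M²a + δ)` transport mismatch is on budget.

CONTENT ([folklore] kinematics at ONE background; 0 sorry; DATA defs `vtxW`, `tinterpW`):
§1 `vtxW`, `tinterpW`; `tinterpW_flat` (at `W ≡ 1` it IS H3's `interp M univ m`), **`tinterpW_corner`** (`= m z` at `M•z`),
   `tinterpW_mem_skewAdjoint`, **`tinterpW_add_period`**;
§2 THE COVARIANT DIFFERENCE FORMULA (exact, any `W`) **`gaugeDir_tinterpW_eq`**: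
   `gaugeDir W (tinterpW M W m) y α = interp M univ (w ↦ Ad_{btree_w(y+e_α)⁻¹}(Ad_{g_w⁻¹} m w − m w)) y − (1∕M) • interp M (univ ∖ α) (cfd α (vtxW M W m (y+e_α))) y`,
   `g_w = gaugeAct (btree M W w) W y α` the axial-gauge bond variable based at `M•w`;
§3 THE TWO TRANSPORT ESTIMATES (small field, `[Nonempty n]`): same vertex `‖Ad_{g_w⁻¹} X − X‖ ≤ 2·|y − M•w|₁·a·‖X‖`
   (`B7Prop1Explicit.axial_bond_bound`, any sign of `y − M•w`), and the coarse-difference slot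
   `‖cfd α (vtxW …) w + Ad_{…}(gaugeDir U m w α)‖ ≤ 2·(ℓ²·a + δ)·‖m w‖` for ANY unitary coarse `U` with `‖U − bseg M W‖ ≤ δ`
   bondwise, `ℓ` = length of the two-leg loop `M•w → bseg → M•(w+e_α) → tree → y′ → tree⁻¹ → M•w`
   (`AveragingDeficitBlockDensity.norm_hol_closed_sub_one_le`, `norm_Ad_sub_Ad_le` BY NAME);
FILE 2 (`NE3CovariantTentInterpolantEnergy`): §4 the POINTWISE bound on every fine bond (`z = blk M y`, loop length `≤ 3dM`)
   `‖gaugeDir W (tinterpW M W m) y α‖² ≤ (4∕M²)·Σ_{T ⊆ univ∖α} ‖gaugeDir U m (z + indic T) α‖² + (8(dMa)² + (16∕M²)(δ + 9d²M²a)²)·Σ_{T ⊆ univ} ‖m (z + indic T)‖²`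
   and §5 THE END `Σ_{y∈periodBox(M·N)} Σ_α ‖gaugeDir W (tinterpW M W m) y α‖² ≤ 2^{d+1}·(M^d∕M²)·Σ_{z∈periodBox N}Σ_α ‖gaugeDir U m z α‖²
      + d·2^d·M^d·(8(dMa)² + (16∕M²)(δ + 9d²M²a)²)·Σ_z ‖m z‖²` — the S7 shape `C_I M^{d−2}[Σ‖D_U m‖² + C(d)((M²a)² + δ²)Σ‖m‖²]`,
   `k`-free, `N`-free; exact transported block means are restored by a dressed bump in a further sequel.

HONEST FRAMING.  Kinematics of OUR competitor at one background in the small-field class; nothing about Bałaban's minimisers;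
(P♮)_W ∕ (ML_w) at W ≠ 1, T-E_w and **NE3 are NOT proved**; spine PROVED 0∕9; finite T⁴ rung (B)+1 — NOT infinite volume, NOT
mass gap, NOT `BetaPertH`, NOT Clay.  PLACEMENT: `Summits/QuantumFields/BalabanUV/`.  HONEST DEPENDENCY (cell page 1): continuum YM
on T⁴ ⇐ BetaPertH ∧ nine spine estimates (0/9 proved); BetaPertH ⇐ (D1) ∧ (D4) ∧ CAP+tail; G-an2-4 gates asym, D1 and NE2/3/4.
-/

set_option autoImplicit false

open scoped BigOperators Matrix.Norms.L2Operator
open Finset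

namespace Summit.QuantumFields.BalabanUV.T4Continuum.NE3CovariantTentInterpolant

open Literature.MathematicalPhysics.QuantumFieldTheory.Balaban1983to89
open B7Prop1Explicit B7Prop2Explicit
open T4AveragingDeficitWall (IsUnitaryCfg SmallField Ad)
open T4AveragingDeficitWallBoundary (periodBox mem_periodBox card_periodBox IsPeriodicCfg sum_periodBox_shift)
open T4AveragingDeficitNonAbelian (Ad_mul Ad_sub)
open AveragingDeficitTransport (Ad_mem_skewAdjoint norm_Ad_of_unitary mem_U1_of_unitary)
open AveragingDeficitNearIdentity (Ad_one norm_Ad_sub_le Ad_sum Ad_real_smul Ad_add)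
open AveragingDeficitBlockDensity (btree bseg btree_mem bseg_mem btree_add_period norm_hol_closed_sub_one_le norm_Ad_sub_Ad_le)
open BlockAveragePushDirGauge (gaugeDir)
open SmoothRefineBlocks (blk res blk_add_res res_nonneg res_lt blk_res_add_period)
open SmoothRefineInterp (indic indic_apply indic_insert cfd interpCore interpCore_add interpCore_shift interp interp_sub interp_fd
  dcoef interp_mem wt)
open NE3CoarseInterpolant (interp_corner normSq_interp_le blk_block)
open NE3BlockLineAverage (sum_periodBox_blocks)
open NE3CombGauge (btree_corner isUnitaryCfg_comb gaugeAct_btree_eq)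

noncomputable section

variable {d : ℕ} {n : Type*} [Fintype n] [DecidableEq n]

/-! ## §1 The covariant tent interpolant: definition, flat case, corners, skewness, periodicity -/

/-- THE VERTEX DATA READ AT THE FINE SITE `y`: `m w` carried from the corner `M•w` to `y` along the tree word `treeWord (y − M•w)`,
i.e. `Ad (btree M W w y)⁻¹ (m w)`. [folklore] -/
def vtxW (M : ℕ) (W : Site d → Fin d → (Matrix n n ℂ)ˣ) (m : Site d → Matrix n n ℂ) (y : Site d) : Site d → Matrix n n ℂ :=
  fun w => Ad (btree M W w y)⁻¹ (m w)

/-- **THE COVARIANT TENT INTERPOLANT**: the multilinear (tent partition-of-unity) combination of the `2^d` cube-vertex data, each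
transported from its own corner. [folklore] -/
def tinterpW (M : ℕ) (W : Site d → Fin d → (Matrix n n ℂ)ˣ) (m : Site d → Matrix n n ℂ) (y : Site d) : Matrix n n ℂ :=
  interp M Finset.univ (vtxW M W m y) y

/-- The transport along any word of the trivial configuration is `1`. [folklore] -/
theorem hol_flat (x : Site d) : ∀ (w : List (Letter d)),
    hol (fun (_ : Site d) (_ : Fin d) => (1 : (Matrix n n ℂ)ˣ)) x w = 1 := by
  intro w
  induction w generalizing x with
  | nil => rfl
  | cons l w ih =>
    rw [hol_cons, ih]
    obtain ⟨μ, b⟩ := l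
    cases b <;> simp [stepHol]

/-- **FLAT CASE**: at `W ≡ 1` the covariant tent interpolant IS the multilinear interpolant of row H3. [folklore] -/
theorem tinterpW_flat (M : ℕ) (m : Site d → Matrix n n ℂ) (y : Site d) :
    tinterpW M (fun _ _ => 1) m y = interp M Finset.univ m y := by
  unfold tinterpW
  congr 1
  funext w
  unfold vtxW btree
  rw [hol_flat, inv_one, Ad_one]

/-- The vertex datum of the corner `M•z` read at `M•z` is the datum. [folklore] -/
theorem vtxW_corner_self (M : ℕ) (W : Site d → Fin d → (Matrix n n ℂ)ˣ) (m : Site d → Matrix n n ℂ) (z : Site d) :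
    vtxW M W m ((M : ℤ) • z) z = m z := by
  unfold vtxW
  rw [btree_corner, inv_one, Ad_one]

/-- **CORNER VALUES**: `tinterpW M W m (M•z) = m z` (`M ≥ 1`). [folklore] -/
theorem tinterpW_corner {M : ℕ} (hM : 1 ≤ M) (W : Site d → Fin d → (Matrix n n ℂ)ˣ) (m : Site d → Matrix n n ℂ) (z : Site d) :
    tinterpW M W m ((M : ℤ) • z) = m z := by
  unfold tinterpW
  rw [interp_corner hM Finset.univ (vtxW M W m ((M : ℤ) • z)) z, vtxW_corner_self]

/-- The vertex data of 𝔲(n)-valued `m` at a unitary background are 𝔲(n)-valued. [folklore] -/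
theorem vtxW_mem_skewAdjoint (M : ℕ) {W : Site d → Fin d → (Matrix n n ℂ)ˣ} (hW : IsUnitaryCfg W) {m : Site d → Matrix n n ℂ}
    (hm : ∀ w, m w ∈ skewAdjoint (Matrix n n ℂ)) (y w : Site d) : vtxW M W m y w ∈ skewAdjoint (Matrix n n ℂ) :=
  Ad_mem_skewAdjoint ((unitaryUnits _).inv_mem (btree_mem hW M w y)) (hm w)

/-- **`tinterpW` IS 𝔲(n)-VALUED** for 𝔲(n)-valued data at a unitary background. [folklore] -/
theorem tinterpW_mem_skewAdjoint (M : ℕ) {W : Site d → Fin d → (Matrix n n ℂ)ˣ} (hW : IsUnitaryCfg W) {m : Site d → Matrix n n ℂ}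
    (hm : ∀ w, m w ∈ skewAdjoint (Matrix n n ℂ)) (y : Site d) : tinterpW M W m y ∈ skewAdjoint (Matrix n n ℂ) :=
  interp_mem (skewAdjoint (Matrix n n ℂ)) (fun r _ hX => skewAdjoint.smul_mem r hX) M Finset.univ
    (vtxW_mem_skewAdjoint M hW hm y) y

/-- Periodicity of the vertex data: shifting the site by `M·N` and the vertex by `N`. [folklore] -/
theorem vtxW_add_period {M N : ℕ} {W : Site d → Fin d → (Matrix n n ℂ)ˣ} (hWP : IsPeriodicCfg W ((M : ℤ) * N))
    {m : Site d → Matrix n n ℂ} (hm : ∀ (z : Site d) (τ : Fin d), m (z + (N : ℤ) • e τ) = m z) (y w : Site d) (τ : Fin d) :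
    vtxW M W m (y + ((M : ℤ) * N) • e τ) (w + (N : ℤ) • e τ) = vtxW M W m y w := by
  unfold vtxW
  rw [btree_add_period M hWP w y τ, hm]

/-- **PERIODICITY**: `(M·N)`-periodic `W` and `N`-periodic `m` give an `(M·N)`-periodic interpolant (`M ≥ 1`). [folklore] -/
theorem tinterpW_add_period {M : ℕ} (hM : 1 ≤ M) {N : ℕ} {W : Site d → Fin d → (Matrix n n ℂ)ˣ}
    (hWP : IsPeriodicCfg W ((M : ℤ) * N)) {m : Site d → Matrix n n ℂ}
    (hm : ∀ (z : Site d) (τ : Fin d), m (z + (N : ℤ) • e τ) = m z) (y : Site d) (τ : Fin d) :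
    tinterpW M W m (y + ((M * N : ℕ) : ℤ) • e τ) = tinterpW M W m y := by
  obtain ⟨hb, hr⟩ := blk_res_add_period (d := d) hM y (N : ℤ) τ
  have hP : ((M * N : ℕ) : ℤ) = (M : ℤ) * (N : ℤ) := by push_cast; ring
  have hw : wt M (y + ((M : ℤ) * (N : ℤ)) • e τ) = wt M y := by
    funext i; simp only [wt, hr]
  unfold tinterpW interp
  rw [hP, hb, hw, interpCore_shift]
  congr 1
  funext x
  exact vtxW_add_period hWP hm y x τ

/-! ## §2 The covariant difference formula -/

/-- `Ad` passes through the interpolation (a real-linear combination). [folklore] -/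
theorem Ad_interp (u : (Matrix n n ℂ)ˣ) (M : ℕ) (S : Finset (Fin d)) (G : Site d → Matrix n n ℂ) (y : Site d) :
    Ad u (interp M S G y) = interp M S (fun w => Ad u (G w)) y := by
  unfold interp interpCore
  rw [Ad_sum]
  refine Finset.sum_congr rfl fun T _ => ?_
  rw [Ad_real_smul]

omit [Fintype n] [DecidableEq n] in
/-- Additivity of the interpolation in the datum. [folklore] -/
theorem interp_add' (M : ℕ) (S : Finset (Fin d)) (G G' : Site d → Matrix n n ℂ) (y : Site d) :
    interp M S (fun w => G w + G' w) y = interp M S G y + interp M S G' y :=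
  interpCore_add _ _ _ _ _

/-- **THE SAME-VERTEX IDENTITY**: reading the vertex datum at `y` through the bond `(y, α)` differs from reading it at `y + e_α`
by the axial-gauge bond variable `g_w = gaugeAct (btree M W w) W y α` based at `M•w`:
`Ad_{W(y,α)⁻¹} (vtxW M W m y w) = Ad_{btree_w(y+e_α)⁻¹} (Ad_{g_w⁻¹} (m w))`. [cite: Balaban1985Averaging, (8) p.18, p.24] -/
theorem Ad_inv_vtxW_eq (M : ℕ) (W : Site d → Fin d → (Matrix n n ℂ)ˣ) (m : Site d → Matrix n n ℂ) (y w : Site d) (α : Fin d) :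
    Ad (W y α)⁻¹ (vtxW M W m y w)
      = Ad (btree M W w (y + e α))⁻¹ (Ad (gaugeAct (btree M W w) W y α)⁻¹ (m w)) := by
  unfold vtxW
  rw [← Ad_mul, ← Ad_mul]
  congr 1
  simp only [gaugeAct, mul_inv_rev, inv_inv, inv_mul_cancel_left]

/-- **THE COVARIANT DIFFERENCE FORMULA** (exact, any `W`, `M ≥ 1`): the covariant gradient of the tent interpolant is the
interpolant of the SAME-VERTEX defects `Ad_{btree_w(y+e_α)⁻¹}(Ad_{g_w⁻¹} m w − m w)` minus `1∕M` times the transverse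
interpolant of the coarse difference of the vertex data read at `y + e_α`. [folklore] -/
theorem gaugeDir_tinterpW_eq {M : ℕ} (hM : 1 ≤ M) (W : Site d → Fin d → (Matrix n n ℂ)ˣ) (m : Site d → Matrix n n ℂ)
    (y : Site d) (α : Fin d) :
    gaugeDir W (tinterpW M W m) y α
      = interp M Finset.univ
          (fun w => Ad (btree M W w (y + e α))⁻¹ (Ad (gaugeAct (btree M W w) W y α)⁻¹ (m w) - m w)) y
        - (1 / (M : ℝ)) • interp M (Finset.univ.erase α) (cfd α (vtxW M W m (y + e α))) y := by
  have h1 : gaugeDir W (tinterpW M W m) y α = Ad (W y α)⁻¹ (tinterpW M W m y) - tinterpW M W m (y + e α) := rfl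
  rw [h1]
  unfold tinterpW
  rw [Ad_interp]
  have h2 : (fun w => Ad (W y α)⁻¹ (vtxW M W m y w))
      = fun w => Ad (btree M W w (y + e α))⁻¹ (Ad (gaugeAct (btree M W w) W y α)⁻¹ (m w) - m w)
          + vtxW M W m (y + e α) w := by
    funext w
    rw [Ad_inv_vtxW_eq, Ad_sub, vtxW, sub_add_cancel]
  rw [h2, interp_add']
  have h3 := interp_fd hM Finset.univ α (vtxW M W m (y + e α)) y
  rw [dcoef, if_pos (Finset.mem_univ α)] at h3
  rw [← h3]
  abel

/-! ## §3 The two transport estimates -/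

section Small

variable [Nonempty n]

/-- **SAME VERTEX**: `‖Ad_{btree_w(y+e_α)⁻¹}(Ad_{g_w⁻¹} X − X)‖ ≤ 2·(|y − M•w|₁·a)·‖X‖` in the small-field class — the axial-gauge
bond variable based at `M•w` is within `|y − M•w|₁·a` of `1` for EVERY relative position of `y` (signed tree words).
[cite: Balaban1985Averaging, pp.24–25] -/
theorem norm_sameVertex_le {M : ℕ} {W : Site d → Fin d → (Matrix n n ℂ)ˣ} (hW : IsUnitaryCfg W) {a : ℝ} (ha : 0 ≤ a)
    (hWa : SmallField W a) (X : Matrix n n ℂ) (y w : Site d) (α : Fin d) :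
    ‖Ad (btree M W w (y + e α))⁻¹ (Ad (gaugeAct (btree M W w) W y α)⁻¹ X - X)‖
      ≤ 2 * ((l1 (y - (M : ℤ) • w) : ℝ) * a) * ‖X‖ := by
  have hg : gaugeAct (btree M W w) W y α ∈ unitaryUnits (Matrix n n ℂ) := isUnitaryCfg_comb hW M w y α
  rw [norm_Ad_of_unitary ((unitaryUnits _).inv_mem (btree_mem hW M w _))]
  refine (norm_Ad_sub_le ((unitaryUnits _).inv_mem hg) X).trans ?_
  have hW1 : ∀ x κ, W x κ ∈ U1 (Matrix n n ℂ) := fun x κ => mem_U1_of_unitary (hW x κ)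
  have hb : ‖((gaugeAct (btree M W w) W y α : (Matrix n n ℂ)ˣ) : Matrix n n ℂ) - 1‖ ≤ l1 (y - (M : ℤ) • w) * a := by
    rw [gaugeAct_btree_eq]
    exact axial_bond_bound W hW1 ((M : ℤ) • w) hWa ha y α
  have hinv := (norm_inv_sub_one_le (mem_U1_of_unitary hg)).trans hb
  gcongr

omit [Nonempty n] in
/-- The coarse-difference slot, EXACTLY: `cfd α (vtxW M W m y′) w + Ad_{btree_{w+e_α}(y′)⁻¹}(gaugeDir U m w α)
= Ad_{btree_{w+e_α}(y′)⁻¹ U(w,α)⁻¹}(m w) − Ad_{btree_w(y′)⁻¹}(m w)` (the `m (w + e_α)` terms cancel). [folklore] -/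
theorem cfd_vtxW_add_eq (M : ℕ) (W U : Site d → Fin d → (Matrix n n ℂ)ˣ) (m : Site d → Matrix n n ℂ) (y' w : Site d) (α : Fin d) :
    cfd α (vtxW M W m y') w + Ad (btree M W (w + e α) y')⁻¹ (gaugeDir U m w α)
      = Ad ((btree M W (w + e α) y')⁻¹ * (U w α)⁻¹) (m w) - Ad (btree M W w y')⁻¹ (m w) := by
  simp only [cfd, vtxW, gaugeDir, Ad_sub, Ad_mul]
  abel

omit [Nonempty n] in
/-- THE TWO-LEG LOOP: `btree_w(y′)·btree_{w+e_α}(y′)⁻¹·bseg(w,α)⁻¹` is the holonomy from `M•w` of the closed word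
`treeWord (y′ − M•w) ++ revWord (treeWord (y′ − M•(w+e_α))) ++ revWord (seg α M)`. [cite: Balaban1985Averaging, (9) p.18] -/
theorem twoLeg_eq_hol (M : ℕ) (W : Site d → Fin d → (Matrix n n ℂ)ˣ) (y' w : Site d) (α : Fin d) :
    btree M W w y' * (btree M W (w + e α) y')⁻¹ * (bseg M W w α)⁻¹
      = hol W ((M : ℤ) • w)
          (treeWord (y' - (M : ℤ) • w)
            ++ (revWord (treeWord (y' - (M : ℤ) • (w + e α))) ++ revWord (seg α (M : ℤ)))) := by
  rw [hol_append, hol_append]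
  simp only [disp_treeWord, disp_revWord]
  have h1 : (M : ℤ) • w + (y' - (M : ℤ) • w) = y' := by abel
  have h2 : y' + -(y' - (M : ℤ) • (w + e α)) = (M : ℤ) • (w + e α) := by abel
  rw [h1, h2,
    hol_revWord' W (x := (M : ℤ) • (w + e α)) y' (treeWord (y' - (M : ℤ) • (w + e α))) (by rw [disp_treeWord]; abel),
    hol_revWord' W (x := (M : ℤ) • w) ((M : ℤ) • (w + e α)) (seg α (M : ℤ)) (by rw [disp_seg, smul_add])]
  simp only [btree, bseg, mul_assoc]

/-- The two-leg word is closed. [folklore] -/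
theorem disp_twoLeg (M : ℕ) (y' w : Site d) (α : Fin d) :
    disp (treeWord (y' - (M : ℤ) • w)
      ++ (revWord (treeWord (y' - (M : ℤ) • (w + e α))) ++ revWord (seg α (M : ℤ) : List (Letter d)))) = 0 := by
  simp only [disp_append, disp_revWord, disp_treeWord, disp_seg, smul_add]
  abel

/-- The length of the two-leg word. [folklore] -/
theorem length_twoLeg (M : ℕ) (y' w : Site d) (α : Fin d) :
    (treeWord (y' - (M : ℤ) • w)
      ++ (revWord (treeWord (y' - (M : ℤ) • (w + e α))) ++ revWord (seg α (M : ℤ) : List (Letter d)))).length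
      = l1 (y' - (M : ℤ) • w) + l1 (y' - (M : ℤ) • (w + e α)) + M := by
  simp only [List.length_append, length_revWord, length_treeWord, length_seg, Int.natAbs_natCast]
  ring

/-- **THE COARSE-DIFFERENCE SLOT**: for ANY unitary coarse `U` whose bond values are within `δ` of the straight transports
`bseg M W`, the vertex-data difference across a coarse bond is the covariant coarse difference up to the two-leg loop and `δ`:
`‖cfd α (vtxW M W m y′) w + Ad_{btree_{w+e_α}(y′)⁻¹}(gaugeDir U m w α)‖ ≤ 2·(ℓ²·a + δ)·‖m w‖`,
`ℓ = |y′ − M•w|₁ + |y′ − M•(w+e_α)|₁ + M`. [cite: Balaban1985Averaging, pp.24–25] -/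
theorem norm_coarseSlot_le {M : ℕ} {W U : Site d → Fin d → (Matrix n n ℂ)ˣ} (hW : IsUnitaryCfg W) (hU : IsUnitaryCfg U)
    {a δ : ℝ} (ha : 0 ≤ a) (hWa : SmallField W a)
    (hδ : ∀ (w : Site d) (α : Fin d), ‖((U w α : (Matrix n n ℂ)ˣ) : Matrix n n ℂ) - bseg M W w α‖ ≤ δ)
    (m : Site d → Matrix n n ℂ) (y' w : Site d) (α : Fin d) :
    ‖cfd α (vtxW M W m y') w + Ad (btree M W (w + e α) y')⁻¹ (gaugeDir U m w α)‖
      ≤ 2 * ((((l1 (y' - (M : ℤ) • w) + l1 (y' - (M : ℤ) • (w + e α)) + M : ℕ) : ℝ)) ^ 2 * a + δ) * ‖m w‖ := by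
  rw [cfd_vtxW_add_eq]
  set A : (Matrix n n ℂ)ˣ := (btree M W (w + e α) y')⁻¹ * (U w α)⁻¹ with hA
  set B : (Matrix n n ℂ)ˣ := (btree M W w y')⁻¹ with hB
  have hAu : A ∈ unitaryUnits (Matrix n n ℂ) :=
    (unitaryUnits _).mul_mem ((unitaryUnits _).inv_mem (btree_mem hW M _ _)) ((unitaryUnits _).inv_mem (hU w α))
  have hBu : B ∈ unitaryUnits (Matrix n n ℂ) := (unitaryUnits _).inv_mem (btree_mem hW M _ _)
  refine (norm_Ad_sub_Ad_le hAu hBu (m w)).trans ?_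
  -- `B⁻¹ A = Λ · R`, `Λ` the two-leg loop, `R = bseg · U⁻¹`
  set Γ : List (Letter d) := treeWord (y' - (M : ℤ) • w)
      ++ (revWord (treeWord (y' - (M : ℤ) • (w + e α))) ++ revWord (seg α (M : ℤ))) with hΓ
  have hsplit : B⁻¹ * A = hol W ((M : ℤ) • w) Γ * (bseg M W w α * (U w α)⁻¹) := by
    rw [hΓ, ← twoLeg_eq_hol, hA, hB, inv_inv]
    group
  have hΛ1 : ‖((hol W ((M : ℤ) • w) Γ : (Matrix n n ℂ)ˣ) : Matrix n n ℂ)‖ ≤ 1 :=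
    (mem_U1.mp (mem_U1_of_unitary (hol_mem_of hW _ _))).1
  have hΛ : ‖((hol W ((M : ℤ) • w) Γ : (Matrix n n ℂ)ˣ) : Matrix n n ℂ) - 1‖
      ≤ (((l1 (y' - (M : ℤ) • w) + l1 (y' - (M : ℤ) • (w + e α)) + M : ℕ) : ℝ)) ^ 2 * a := by
    have h := norm_hol_closed_sub_one_le hW ha hWa ((M : ℤ) • w) Γ (by rw [hΓ]; exact disp_twoLeg M y' w α)
    rwa [hΓ, length_twoLeg] at h
  have hR : ‖((bseg M W w α * (U w α)⁻¹ : (Matrix n n ℂ)ˣ) : Matrix n n ℂ) - 1‖ ≤ δ := by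
    have hUi1 : ‖(((U w α)⁻¹ : (Matrix n n ℂ)ˣ) : Matrix n n ℂ)‖ ≤ 1 := (mem_U1.mp (mem_U1_of_unitary (hU w α))).2
    have e1 : ((bseg M W w α * (U w α)⁻¹ : (Matrix n n ℂ)ˣ) : Matrix n n ℂ) - 1
        = ((bseg M W w α : Matrix n n ℂ) - (U w α : Matrix n n ℂ)) * (((U w α)⁻¹ : (Matrix n n ℂ)ˣ) : Matrix n n ℂ) := by
      rw [Units.val_mul, sub_mul, Units.mul_inv]
    rw [e1]
    calc _ ≤ ‖(bseg M W w α : Matrix n n ℂ) - (U w α : Matrix n n ℂ)‖ * ‖(((U w α)⁻¹ : (Matrix n n ℂ)ˣ) : Matrix n n ℂ)‖ :=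
          norm_mul_le _ _
      _ ≤ δ * 1 := by
          refine mul_le_mul ?_ hUi1 (norm_nonneg _) ((norm_nonneg _).trans (hδ w α))
          rw [norm_sub_rev]; exact hδ w α
      _ = δ := mul_one δ
  have hprod : ‖((B⁻¹ * A : (Matrix n n ℂ)ˣ) : Matrix n n ℂ) - 1‖
      ≤ (((l1 (y' - (M : ℤ) • w) + l1 (y' - (M : ℤ) • (w + e α)) + M : ℕ) : ℝ)) ^ 2 * a + δ := by
    rw [hsplit, Units.val_mul]
    exact (B8Ineq170.norm_mul_sub_one_le_of_norm_le_one hΛ1).trans (add_le_add hΛ hR)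
  have h0 : 0 ≤ (((l1 (y' - (M : ℤ) • w) + l1 (y' - (M : ℤ) • (w + e α)) + M : ℕ) : ℝ)) ^ 2 * a + δ :=
    (norm_nonneg _).trans hprod
  gcongr

end Small

end

end Summit.QuantumFields.BalabanUV.T4Continuum.NE3CovariantTentInterpolant
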